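import Literature.AnabelianGeometry.EtaleTheta.Discharge.Sec2PiTpCResiduallyFinite
import Literature.AnabelianGeometry.EtaleTheta.Discharge.Sec2Prop24Reduction
import Literature.AnabelianGeometry.SemiGraphs.TemperedCompletionExtension
import Literature.AnabelianGeometry.SemiGraphs.TemperedCompletionOpenSubgroups
import HarnessLib

/-!
# [EtTh] §2 over §1: `Π_X ⊆ Π_C` — the profinite completion of `Π^tp_X` sits in any profinite
# completion of `Π^tp_C` as an OPEN subgroup of index `2` (proof-only; W3-L2-02 phase-2 plumbing)

Mochizuki, *The étale theta function and its Frobenioid-theoretic manifestations*, Publ. RIMS **45**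
(2009), §2 p. 36 (printed 262): "`Π_X ⊆ Π_C` … `Gal(X/C) ≅ ℤ/2ℤ`" for the profinite étale fundamental
groups, `Π_X := (Π^tp_X)^∧` (§1 p. 12) [cite: MochizukiEtTh2009, Def 2.1 p.36].

Cell abc-iut, layer L2, W3-L2-02 (seat abc-iut-L2-d3), PROOF-ONLY companion (no `def`) of
`MuTwoSettingCLevel.lean`. For `M : MuTwoSetting p` with C-level data `e : M.CLevelData` (open embedding
`Π^tp_X ↪ Π^tp_C`) and ANY profinite completion `ιC : Π^tp_C → P_C` (abc-iut-L3's frozen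
`IsProfiniteCompletion`; one exists and is injective by `Sec2PiTpCResiduallyFinite`), PROVED:

* `exists_hatInclX` — there is a continuous homomorphism `Φ : Π_X → P_C` extending `ιC ∘ inclX` along
  `toHat : Π^tp_X → Π_X` (L3 `IsProfiniteCompletion.exists_extension`), unique (`hatInclX_unique`);
* `isDOFType_range_inclX` — `inclX(Π^tp_X)` is of DOF-type in `Π^tp_C` (open of finite index `2`);
* `isOpen_range_hatInclX` — `Φ(Π_X)` is OPEN in `P_C` (L3 `isOpen_range_of_extends`, [SemiAnbd] Thm. 6.4);
* `exists_openNormal_range_hatInclX_eq` / `index_range_hatInclX` — `Φ(Π_X)` is the open normal subgroup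
  of `P_C` pulled back to `Π^tp_X ⊆ Π^tp_C`, of index `2` ("`Gal(X/C) ≅ ℤ/2ℤ`");
* `injective_hatInclX` / `isOpenEmbedding_hatInclX` — `Φ` is injective (the finite-index open normal
  subgroups of `Π^tp_X` coming from `Π^tp_C` are cofinal: normal cores) and an OPEN EMBEDDING.

This is the plumbing the `CoverData`/`TemperedCoverData` model record needs to move the `Π_X`-side
subgroups (abc-iut-L2-t10's `barKerHat`/`barThetaHat`, the cusp `D_x`) into `Π_C`. Nothing here asserts
that a `MuTwoSetting` exists; no side is taken on [IUTchIII] Cor. 3.12; typed ≠ proved.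
-/

noncomputable section

namespace Literature.AnabelianGeometry.EtaleTheta

open Literature.AnabelianGeometry.SemiGraphs
open _root_.Topology

namespace MuTwoSetting.CLevelData

universe w

variable {p : ℕ} [Fact p.Prime] {M : MuTwoSetting p}
variable {PC : Type w} [Group PC] [TopologicalSpace PC] [IsTopologicalGroup PC]

/-- `inclX : Π^tp_X → Π^tp_C` as a continuous homomorphism. (Local abbreviation through a theorem-free
term; no definition is introduced.) [cite: MochizukiEtTh2009, Def 1.7 p.27] -/
theorem continuous_inclX' : Continuous (M.inclX : M.PiTemp → M.GtpC) := M.continuous_inclX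

/-- **The extension `Φ : Π_X → P_C` of `ιC ∘ inclX`** along the profinite completion `toHat : Π^tp_X → Π_X`
exists (universal property of the profinite completion, L3 `exists_extension`; `P_C` is profinite).
[cite: MochizukiEtTh2009, Def 2.1 p.36] -/
theorem exists_hatInclX (ιC : M.GtpC →ₜ* PC) (hιC : IsProfiniteCompletion ιC) :
    ∃ Φ : M.PiHat →ₜ* PC, ∀ x : M.PiTemp, Φ (M.toHat x) = ιC (M.inclX x) := by
  haveI : CompactSpace PC := hιC.compactSpace
  haveI : TotallyDisconnectedSpace PC := hιC.totallyDisconnectedSpace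
  exact IsProfiniteCompletion.exists_extension M.isProfiniteCompletion_toHat
    (ιC.comp ⟨M.inclX, M.continuous_inclX⟩)

omit [IsTopologicalGroup PC] in
/-- The extension is unique (`Π^tp_X` is dense in `Π_X`, `P_C` is Hausdorff).
[cite: MochizukiEtTh2009, Def 2.1 p.36] -/
theorem hatInclX_unique (ιC : M.GtpC →ₜ* PC) (hιC : IsProfiniteCompletion ιC) (Φ Ψ : M.PiHat →ₜ* PC)
    (hΦ : ∀ x : M.PiTemp, Φ (M.toHat x) = ιC (M.inclX x))
    (hΨ : ∀ x : M.PiTemp, Ψ (M.toHat x) = ιC (M.inclX x)) : Φ = Ψ := by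
  haveI : T2Space PC := hιC.t2Space
  exact IsProfiniteCompletion.extension_unique M.isProfiniteCompletion_toHat Φ Ψ
    fun x => by rw [hΦ, hΨ]

/-- `inclX(Π^tp_X)` is of DOF-type in `Π^tp_C`: it is itself open (field `isOpen_range_inclX`), of finite
index `2` (field `index_range_inclX`), and closed. [cite: MochizukiEtTh2009, Def 1.7 p.27] -/
theorem isDOFType_range_inclX (M : MuTwoSetting p) :
    IsDOFType (⟨M.inclX, M.continuous_inclX⟩ : M.PiTemp →ₜ* M.GtpC).toMonoidHom.range := by
  refine ⟨M.inclX.range, M.isOpen_range_inclX, ⟨by rw [M.index_range_inclX]; exact two_ne_zero⟩, ?_⟩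
  change closure ((M.inclX.range : Subgroup M.GtpC) : Set M.GtpC) = _
  exact (M.inclX.range.isClosed_of_isOpen M.isOpen_range_inclX).closure_eq

/-- **`Φ(Π_X)` is open in `P_C`** ("profinite completion yields an open homomorphism", [SemiAnbd] Thm. 6.4,
via L3 `isOpen_range_of_extends`). [cite: MochizukiEtTh2009, Def 2.1 p.36] -/
theorem isOpen_range_hatInclX (ιC : M.GtpC →ₜ* PC) (hιC : IsProfiniteCompletion ιC) (Φ : M.PiHat →ₜ* PC)
    (hΦ : ∀ x : M.PiTemp, Φ (M.toHat x) = ιC (M.inclX x)) : IsOpen (Set.range Φ) :=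
  IsProfiniteCompletion.isOpen_range_of_extends M.isProfiniteCompletion_toHat hιC
    ⟨M.inclX, M.continuous_inclX⟩ Φ hΦ (isDOFType_range_inclX M)

omit [IsTopologicalGroup PC] in
/-- The range of `Φ` is the CLOSURE of `ιC(inclX(Π^tp_X))` (`toHat` has dense range, `Φ(Π_X)` is compact).
[cite: MochizukiEtTh2009, Def 2.1 p.36] -/
theorem range_hatInclX_eq_closure (ιC : M.GtpC →ₜ* PC) (hιC : IsProfiniteCompletion ιC)
    (Φ : M.PiHat →ₜ* PC) (hΦ : ∀ x : M.PiTemp, Φ (M.toHat x) = ιC (M.inclX x)) :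
    Set.range Φ = closure (ιC '' ((M.inclX.range : Subgroup M.GtpC) : Set M.GtpC)) := by
  haveI : CompactSpace M.PiHat := M.isProfiniteCompletion_toHat.compactSpace
  haveI : T2Space PC := hιC.t2Space
  have himg : Φ '' Set.range M.toHat = ιC '' ((M.inclX.range : Subgroup M.GtpC) : Set M.GtpC) := by
    ext z
    constructor
    · rintro ⟨_, ⟨x, rfl⟩, rfl⟩
      exact ⟨M.inclX x, ⟨x, rfl⟩, (hΦ x).symm⟩
    · rintro ⟨_, ⟨x, rfl⟩, rfl⟩
      exact ⟨M.toHat x, ⟨x, rfl⟩, hΦ x⟩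
  apply le_antisymm
  · have hd : closure (Set.range M.toHat) = Set.univ := M.isProfiniteCompletion_toHat.denseRange.closure_range
    rw [← himg, ← Set.image_univ, ← hd]
    exact image_closure_subset_closure_image Φ.continuous
  · rw [← himg]
    exact closure_minimal (Set.image_subset_range _ _) (isCompact_range Φ.continuous).isClosed

/-- **`Φ(Π_X)` is an open NORMAL subgroup of `P_C` whose pull-back to `Π^tp_C` is `inclX(Π^tp_X)`**
(the open normal subgroup of finite index `Π^tp_X ⊴ Π^tp_C` comes from the completion,
`IsProfiniteCompletion.comap_surjective`; its closure description is L3's `closure_image_comap`).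
[cite: MochizukiEtTh2009, Def 2.1 p.36] -/
theorem exists_openNormal_range_hatInclX_eq (ιC : M.GtpC →ₜ* PC) (hιC : IsProfiniteCompletion ιC)
    (Φ : M.PiHat →ₜ* PC) (hΦ : ∀ x : M.PiTemp, Φ (M.toHat x) = ιC (M.inclX x)) :
    ∃ V : OpenNormalSubgroup PC, M.inclX.range = V.toSubgroup.comap ιC.toMonoidHom ∧
      Set.range Φ = (V.toSubgroup : Set PC) := by
  let N : OpenNormalSubgroup M.GtpC := ⟨⟨M.inclX.range, M.isOpen_range_inclX⟩, M.range_inclX_normal⟩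
  obtain ⟨V, hV⟩ := hιC.comap_surjective N ⟨by
    change M.inclX.range.index ≠ 0
    rw [M.index_range_inclX]; exact two_ne_zero⟩
  refine ⟨V, hV, ?_⟩
  rw [range_hatInclX_eq_closure ιC hιC Φ hΦ, show (M.inclX.range : Subgroup M.GtpC) = N.toSubgroup from rfl,
    hV]
  exact IsProfiniteCompletion.closure_image_comap hιC V

/-- **`[P_C : Φ(Π_X)] = 2`** ("`Gal(X/C) ≅ ℤ/2ℤ`", p. 36): the index of the open subgroup is computed on
the dense image of `Π^tp_C` (abc-iut-L2-t7's `Subgroup.index_comap_of_denseRange`).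
[cite: MochizukiEtTh2009, Def 2.1 p.36] -/
theorem index_range_hatInclX (ιC : M.GtpC →ₜ* PC) (hιC : IsProfiniteCompletion ιC)
    (Φ : M.PiHat →ₜ* PC) (hΦ : ∀ x : M.PiTemp, Φ (M.toHat x) = ιC (M.inclX x)) :
    Φ.toMonoidHom.range.index = 2 := by
  obtain ⟨V, hV, hrange⟩ := exists_openNormal_range_hatInclX_eq ιC hιC Φ hΦ
  have hVeq : Φ.toMonoidHom.range = V.toSubgroup := by
    apply SetLike.coe_injective
    rw [MonoidHom.coe_range]
    exact hrange
  rw [hVeq, ← Subgroup.index_comap_of_denseRange ιC.toMonoidHom hιC.denseRange V.toSubgroup V.isOpen',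
    ← hV, M.index_range_inclX]

/-! ### Injectivity: `Π_X ↪ P_C` is an open embedding -/

omit [IsTopologicalGroup PC] in
/-- **`Φ : Π_X → P_C` is injective**: the open normal subgroups of finite index of `Π^tp_X` that come from
`Π^tp_C` (normal cores of images under the open embedding `inclX`) are cofinal, so `Π_X` embeds in the
completion of `Π^tp_C`. Concretely, for `z ≠ 1` pick an open normal `V₁ ≤ Π_X` missing `z`; the normal
core `N` in `Π^tp_C` of `inclX(toHat⁻¹ V₁)` comes from an open normal `V₃ ≤ P_C`, its trace `N'` on
`Π^tp_X` from an open normal `V₂ ≤ V₁`; then `Φ⁻¹(V₃) ⊆ V₂` by density, so `Φ z ≠ 1`.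
[cite: MochizukiEtTh2009, Def 2.1 p.36] -/
theorem injective_hatInclX (e : M.CLevelData) (ιC : M.GtpC →ₜ* PC) (hιC : IsProfiniteCompletion ιC)
    (Φ : M.PiHat →ₜ* PC) (hΦ : ∀ x : M.PiTemp, Φ (M.toHat x) = ιC (M.inclX x)) :
    Function.Injective Φ := by
  classical
  haveI : CompactSpace M.PiHat := M.isProfiniteCompletion_toHat.compactSpace
  haveI : T2Space M.PiHat := M.isProfiniteCompletion_toHat.t2Space
  haveI : TotallyDisconnectedSpace M.PiHat := M.isProfiniteCompletion_toHat.totallyDisconnectedSpace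
  rw [injective_iff_map_eq_one]
  intro z hz
  by_contra hne
  obtain ⟨V₁, hV₁⟩ := ProfiniteGrp.exist_openNormalSubgroup_sub_open_nhds_of_one
    (isOpen_compl_singleton (x := z)) (by simpa using fun h : (1 : M.PiHat) = z => hne h.symm)
  -- `W = toHat⁻¹ V₁`, `H = inclX(W)`, `N` = its normal core in `Π^tp_C`
  let W : Subgroup M.PiTemp := V₁.toSubgroup.comap M.toHat.toMonoidHom
  have hWo : IsOpen (W : Set M.PiTemp) := V₁.isOpen'.preimage M.toHat.continuous
  haveI : W.FiniteIndex := finiteIndex_comap_toHat V₁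
  let H : Subgroup M.GtpC := W.map M.inclX
  have hHo : IsOpen (H : Set M.GtpC) := by
    rw [Subgroup.coe_map]; exact e.isOpenEmbedding_inclX.isOpenMap _ hWo
  haveI : H.FiniteIndex := finiteIndex_map_inclX W
  let N : OpenNormalSubgroup M.GtpC :=
    ⟨⟨H.normalCore, Subgroup.isOpen_of_isClosed_of_finiteIndex _
      (H.normalCore_isClosed (H.isClosed_of_isOpen hHo))⟩, inferInstance⟩
  haveI hNfi : N.toSubgroup.FiniteIndex := Subgroup.finiteIndex_normalCore H
  -- `N' = inclX⁻¹ N ≤ W`, open normal of finite index in `Π^tp_X`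
  let N' : OpenNormalSubgroup M.PiTemp :=
    ⟨⟨N.toSubgroup.comap M.inclX, N.isOpen'.preimage M.continuous_inclX⟩, Subgroup.normal_comap _⟩
  have hN'W : N'.toSubgroup ≤ W := by
    intro x hx
    have hx' : M.inclX x ∈ H := H.normalCore_le hx
    exact (Subgroup.mem_map_iff_mem M.injective_inclX).1 hx'
  have hN'fi : N'.toSubgroup.FiniteIndex := by
    haveI : N.toSubgroup.IsFiniteRelIndex M.inclX.range := Subgroup.isFiniteRelIndex_of_finiteIndex
    exact ⟨by
      change (N.toSubgroup.comap M.inclX).index ≠ 0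
      rw [Subgroup.index_comap]; exact Subgroup.relIndex_ne_zero⟩
  obtain ⟨V₂, hV₂⟩ := M.isProfiniteCompletion_toHat.comap_surjective N' hN'fi
  obtain ⟨V₃, hV₃⟩ := hιC.comap_surjective N hNfi
  -- `V₂ ⊆ V₁`
  have hV₂V₁ : (V₂.toSubgroup : Set M.PiHat) ⊆ V₁.toSubgroup := by
    rw [← IsProfiniteCompletion.closure_image_comap M.isProfiniteCompletion_toHat V₂, ← hV₂]
    refine closure_minimal ?_ (V₁.toSubgroup.isClosed_of_isOpen V₁.isOpen')
    rintro _ ⟨x, hx, rfl⟩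
    exact hN'W hx
  -- `Φ⁻¹ V₃ ⊆ V₂` by density of `toHat(Π^tp_X)` in the open set `Φ⁻¹ V₃`
  have hA : (Φ ⁻¹' (V₃.toSubgroup : Set PC)) ⊆ (V₂.toSubgroup : Set M.PiHat) := by
    have hAo : IsOpen (Φ ⁻¹' (V₃.toSubgroup : Set PC)) := V₃.isOpen'.preimage Φ.continuous
    have h1 : Φ ⁻¹' (V₃.toSubgroup : Set PC) ∩ Set.range M.toHat ⊆
        M.toHat '' ((N'.toSubgroup : Subgroup M.PiTemp) : Set M.PiTemp) := by
      rintro _ ⟨hy, ⟨x, rfl⟩⟩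
      refine ⟨x, ?_, rfl⟩
      change x ∈ N.toSubgroup.comap M.inclX
      rw [Subgroup.mem_comap, hV₃, Subgroup.mem_comap]
      change ιC (M.inclX x) ∈ V₃.toSubgroup
      rw [← hΦ]
      exact hy
    calc Φ ⁻¹' (V₃.toSubgroup : Set PC)
        ⊆ closure (Φ ⁻¹' (V₃.toSubgroup : Set PC) ∩ Set.range M.toHat) :=
          M.isProfiniteCompletion_toHat.denseRange.open_subset_closure_inter hAo
      _ ⊆ closure (M.toHat '' ((N'.toSubgroup : Subgroup M.PiTemp) : Set M.PiTemp)) := closure_mono h1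
      _ = (V₂.toSubgroup : Set M.PiHat) := by
          rw [hV₂]; exact IsProfiniteCompletion.closure_image_comap M.isProfiniteCompletion_toHat V₂
  have hz3 : z ∈ Φ ⁻¹' (V₃.toSubgroup : Set PC) := by
    change Φ z ∈ V₃.toSubgroup
    rw [hz]; exact one_mem _
  exact hV₁ (hV₂V₁ (hA hz3)) rfl

/-- **`Φ : Π_X → P_C` is an OPEN EMBEDDING** (continuous injective from the compact `Π_X` to the
Hausdorff `P_C` with open range): "`Π_X ⊆ Π_C`" as an open subgroup (p. 36).
[cite: MochizukiEtTh2009, Def 2.1 p.36] -/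
theorem isOpenEmbedding_hatInclX (e : M.CLevelData) (ιC : M.GtpC →ₜ* PC) (hιC : IsProfiniteCompletion ιC)
    (Φ : M.PiHat →ₜ* PC) (hΦ : ∀ x : M.PiTemp, Φ (M.toHat x) = ιC (M.inclX x)) :
    IsOpenEmbedding Φ := by
  haveI : CompactSpace M.PiHat := M.isProfiniteCompletion_toHat.compactSpace
  haveI : T2Space PC := hιC.t2Space
  exact ⟨(Φ.continuous.isClosedEmbedding (e.injective_hatInclX ιC hιC Φ hΦ)).isEmbedding,
    isOpen_range_hatInclX ιC hιC Φ hΦ⟩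

end MuTwoSetting.CLevelData

end Literature.AnabelianGeometry.EtaleTheta

end
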